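import Literature.Topology.FourManifolds.FlatDiscPlaneComplementPi1
import Literature.Topology.FourManifolds.CircleMapSliceLift
import HarnessLib

/-!
# The circle map of a flat-disc exterior is the fibre phase near the plane

Topic `Literature/Topology/FourManifolds`; sibling (theorems only) of `FlatDiscMeridianLongitude.lean` and
`FlatDiscPlaneComplementPi1.lean`, for the topological half of the Fox–Milnor programme (the named
fact `Literature.Topology.FourManifolds.exists_eq_mul_invert_of_isTopologicallySlice`, `SliceKnots.lean`).
For the product neighbourhood `F` of a flat slice disc, with radial extension `radialExt F`, closed
flat plane `P ⊆ ℝ⁴` and punctured neighbourhood `Ψ : ℝ² × (ℂ ∖ 0) ≃ₜ (ℝ⁴ ∖ P) ∩ N`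
(`TopFlatDisc.puncturedHomeomorph`), `FlatDiscPlaneComplementPi1.lean` provides a circle-valued map
`θ₀ : ℝ⁴ ∖ P → S¹` along which the meridian winds once. Here it is normalised near the plane, as in
Livingston (2005), §2, proof of Thm. 2.6 ("using obstruction theory to define a map `B⁴ − D → S¹` […]";
the map is taken to be the projection `∂(D × D²) = D × S¹ → S¹` on the boundary of the tube — this is
where the triviality of the normal bundle of `D` enters), §6 (locally flat category):

* `TopFlatDisc.isClosed_image_radialExt_closedBall` — the closed tube `radialExt F (ℝ² × B̄(0, R))` is
  closed in `ℝ⁴` (a proper map);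
* `TopFlatDisc.exists_circleMap_eq_phase_near_plane` — **there is `θ : ℝ⁴ ∖ P → S¹` which on the closed
  unit tube is the fibre phase, `θ (radialExt F (x, z)) = z / ‖z‖` (`0 < ‖z‖ ≤ 1`), and winds once along
  every plane meridian of fibre radius `≤ 1`.** Proof: on the model `ℝ² × (ℂ ∖ 0)` the quotient
  `θ₀ / phase` winds `0` times along the slice winding loop (`1 - 1`), hence is `exp` of a continuous
  real function `Λ` (`CircleMaps.exists_lift_of_winding_sliceWindingLoop_eq_zero`, Hatcher Prop. 1.33);
  cut `Λ` off at fibre radius `2`, extend by zero (continuous since the closed tube of radius `2` is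
  closed) and put `θ = θ₀ · exp(-χΛ)`;
* `TopFlatDisc.exists_circleMap_complement_eq_phase` — its restriction `θ ∘ ι : S³ ∖ K → S¹` is the
  fibre phase `F (x, z) ↦ z / ‖z‖` on the closed unit flat tube of `K` and winds `1` / `0` times along
  the meridian / longitude of the flat tube (the flat-tube counterpart of
  `Knot.exists_circleMap_eq_angle_of_hasFraming_zero`, extending over the disc exterior).

Everything is proved; no definitions, no named facts.

## References

* C. Livingston, *A survey of classical knot concordance*, Handbook of Knot Theory (2005), §2
  Thm. 2.6 (proof) and §6. [Livingston2005]
* A. Hatcher, *Algebraic Topology*, CUP 2002, §1.3 Prop. 1.33. [HatcherAT2002]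
-/

noncomputable section

open Set Function Metric Filter Topology CategoryTheory Limits
open Literature.AlgebraicTopology.SingularHomology
open Literature.AlgebraicTopology.FundamentalGroup.PuncturedPlane

namespace Literature.Topology.FourManifolds

namespace TopFlatDisc

variable {F : EuclideanSpace ℝ (Fin 2) × EuclideanSpace ℝ (Fin 2) → EuclideanSpace ℝ (Fin 4)}

/-! ### Normalising the circle map near the plane -/

section NearPlane

variable (hemb : IsEmbedding ((Metric.closedBall (0 : EuclideanSpace ℝ (Fin 2)) 1 ×ˢ
  (univ : Set (EuclideanSpace ℝ (Fin 2)))).restrict F))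
variable (hnorm : ∀ x w : EuclideanSpace ℝ (Fin 2),
  ‖x‖ ≤ 1 → ‖F (x, w)‖ ≤ 1 ∧ (‖F (x, w)‖ = 1 ↔ ‖x‖ = 1))
include hemb hnorm

/-- **The closed tube of fibre radius `R` of the plane is closed in `ℝ⁴`**: the image
`radialExt F (ℝ² × B̄(0, R))` (the restriction of the radial extension to `ℝ² × B̄(0, R)` is a proper
map, `‖radialExt F (x, w)‖ = ‖x‖` for `‖x‖ ≥ 1`). [folklore] -/
theorem isClosed_image_radialExt_closedBall (R : ℝ) :
    IsClosed (radialExt F '' (univ ×ˢ Metric.closedBall (0 : EuclideanSpace ℝ (Fin 2)) R)) := by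
  -- the restriction to `ℝ² × B̄(0, R)`, a proper map
  set h : EuclideanSpace ℝ (Fin 2) × ↥(Metric.closedBall (0 : EuclideanSpace ℝ (Fin 2)) R) →
      EuclideanSpace ℝ (Fin 4) := fun p => radialExt F (p.1, p.2) with hh
  have hc : Continuous h :=
    (continuous_radialExt hemb).comp (continuous_fst.prodMk (continuous_subtype_val.comp continuous_snd))
  haveI : CompactSpace ↥(Metric.closedBall (0 : EuclideanSpace ℝ (Fin 2)) R) :=
    isCompact_iff_compactSpace.1 (isCompact_closedBall _ _)
  have ht : Tendsto h (cocompact _) (cocompact _) := by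
    rw [← Metric.cobounded_eq_cocompact (α := EuclideanSpace ℝ (Fin 4)), ← comap_norm_atTop,
      tendsto_comap_iff, ← Filter.coprod_cocompact,
      (Filter.cocompact_eq_bot : cocompact ↥(Metric.closedBall (0 : EuclideanSpace ℝ (Fin 2)) R) = ⊥)]
    simp only [Filter.coprod, Filter.comap_bot, sup_bot_eq]
    have h1 : Tendsto (fun p : EuclideanSpace ℝ (Fin 2) ×
        ↥(Metric.closedBall (0 : EuclideanSpace ℝ (Fin 2)) R) => ‖p.1‖)
        (comap Prod.fst (cocompact _)) atTop :=
      (tendsto_norm_cocompact_atTop (E := EuclideanSpace ℝ (Fin 2))).comp tendsto_comap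
    refine h1.congr' ?_
    have hmem : {x : EuclideanSpace ℝ (Fin 2) | 1 ≤ ‖x‖} ∈ cocompact (EuclideanSpace ℝ (Fin 2)) := by
      refine Filter.mem_cocompact.2 ⟨Metric.closedBall 0 1, isCompact_closedBall 0 1, ?_⟩
      intro x hx
      simp only [mem_compl_iff, mem_closedBall_zero_iff, not_le] at hx
      exact hx.le
    filter_upwards [preimage_mem_comap hmem] with p hp
    exact (norm_radialExt_of_one_le hnorm hp).symm
  have hp : IsProperMap h := isProperMap_iff_tendsto_cocompact.2 ⟨hc, ht⟩
  have hrange : range h = radialExt F '' (univ ×ˢ Metric.closedBall (0 : EuclideanSpace ℝ (Fin 2)) R) := by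
    ext y
    constructor
    · rintro ⟨⟨x, w⟩, rfl⟩
      exact ⟨(x, w), ⟨mem_univ _, w.2⟩, rfl⟩
    · rintro ⟨⟨x, w⟩, ⟨-, hw⟩, rfl⟩
      exact ⟨(x, ⟨w, hw⟩), rfl⟩
  rw [← hrange]
  exact hp.isClosedMap.isClosed_range

omit hemb hnorm in
/-- The phase `z / ‖z‖` of a nonzero complex number has norm one. [folklore] -/
theorem norm_inv_norm_mul (z : CStar) : ‖((‖(z : ℂ)‖⁻¹ : ℝ) : ℂ) * (z : ℂ)‖ = 1 := by
  rw [norm_mul, Complex.norm_real, norm_inv, norm_norm, inv_mul_cancel₀ (norm_ne_zero_iff.2 z.2)]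

/-- **The circle map of the flat-disc exterior can be chosen to be the fibre phase near the
plane**: there is `θ : ℝ⁴ ∖ P → S¹` which on the closed unit tube `radialExt F (ℝ² × (B̄(0,1) ∖ 0))`
is `radialExt F (x, z) ↦ z / ‖z‖`, and (hence) winds once along every plane meridian of fibre
radius `≤ 1` (Livingston 2005, §2, proof of Thm. 2.6: the map `B⁴ − D → S¹` is taken to be the
projection `∂(D × D²) → S¹` near the disc; here for the flat disc completed to the plane `P`, by
the lifting criterion on the punctured neighbourhood `ℝ² × (ℂ ∖ 0)`,
`CircleMaps.exists_lift_of_winding_sliceWindingLoop_eq_zero`, and a cut-off).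
[cite: Livingston2005, §2 Thm. 2.6] -/
theorem exists_circleMap_eq_phase_near_plane :
    ∃ θ : C(↥(mvU F), Circle),
      (∀ (x : EuclideanSpace ℝ (Fin 2)) (z : CStar) (hz : ‖(z : ℂ)‖ ≤ 1),
        (θ (subsetInclusion (inter_subset_left : mvU F ∩ mvV F ⊆ mvU F)
          (puncturedHomeomorph hemb hnorm (x, z))) : ℂ) = (‖(z : ℂ)‖⁻¹ : ℂ) * (z : ℂ)) ∧
      (∀ (x₀ : EuclideanSpace ℝ (Fin 2)) (r : ℝ) (hr : 0 < r) (h1 : r ≤ 1),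
        CircleMaps.winding θ (planeMeridian hemb hnorm x₀ r hr) = 1) := by
  set Ψ := puncturedHomeomorph hemb hnorm with hΨ
  set ι := subsetInclusion (inter_subset_left : mvU F ∩ mvV F ⊆ mvU F) with hι
  obtain ⟨θ₀, hθ₀, -⟩ := exists_circleMap_winding_planeMeridian hemb hnorm 0 1 one_pos
  -- the fibre phase on the model `ℝ² × (ℂ ∖ 0)`
  let phase : C(EuclideanSpace ℝ (Fin 2) × CStar, Circle) :=
    ⟨fun p => ⟨((‖(p.2 : ℂ)‖⁻¹ : ℝ) : ℂ) * (p.2 : ℂ), mem_sphere_zero_iff_norm.2 (norm_inv_norm_mul p.2)⟩,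
      by
        refine Continuous.subtype_mk ?_ _
        exact (Complex.continuous_ofReal.comp ((continuous_norm.comp
          (continuous_subtype_val.comp continuous_snd)).inv₀ fun p => norm_ne_zero_iff.2 p.2.2)).mul
          (continuous_subtype_val.comp continuous_snd)⟩
  have hphase : ∀ p : EuclideanSpace ℝ (Fin 2) × CStar,
      ((phase p : Circle) : ℂ) = ((‖(p.2 : ℂ)‖⁻¹ : ℝ) : ℂ) * (p.2 : ℂ) := fun p => rfl
  -- `θ₀` pulled back to the model, divided by the phase, has slice winding `0`
  let Θ : C(EuclideanSpace ℝ (Fin 2) × CStar, Circle) :=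
    θ₀.comp (ι.comp (Ψ : C(EuclideanSpace ℝ (Fin 2) × CStar, ↥(mvU F ∩ mvV F))))
  have hΘw : CircleMaps.winding Θ (sliceWindingLoop (0 : EuclideanSpace ℝ (Fin 2)) 1 one_pos) = 1 := by
    rw [← hθ₀]
    exact CircleMaps.winding_congr _ _ _ _ fun t => rfl
  have hphw : CircleMaps.winding phase (sliceWindingLoop (0 : EuclideanSpace ℝ (Fin 2)) 1 one_pos) = 1 := by
    refine CircleMaps.winding_eq_of_lift phase _ (G := fun t : unitInterval => 2 * Real.pi * t)
      (by fun_prop) (fun t => ?_) 1 (by simp)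
    apply Subtype.ext
    rw [hphase, sliceWindingLoop_apply, Circle.coe_exp]
    simp only [windingLoop_apply_coe, Complex.ofReal_one, one_mul, Int.cast_one, mul_one]
    rw [Complex.norm_exp_ofReal_mul_I, inv_one, Complex.ofReal_one, one_mul]
  set G : C(EuclideanSpace ℝ (Fin 2) × CStar, Circle) := Θ * phase⁻¹ with hG
  have hGw : CircleMaps.winding G (sliceWindingLoop (0 : EuclideanSpace ℝ (Fin 2)) 1 one_pos) = 0 := by
    rw [hG, CircleMaps.winding_mul, CircleMaps.winding_inv, hΘw, hphw]; norm_num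
  -- lift `G = exp ∘ Λ`
  obtain ⟨Λ, hΛ⟩ := CircleMaps.exists_lift_of_winding_sliceWindingLoop_eq_zero G 0 hGw
  have hΘeq : ∀ p, Θ p = Circle.exp (Λ p) * phase p := fun p => by
    rw [hΛ p, hG]
    simp
  -- transfer `Λ` to the punctured neighbourhood and cut it off at fibre radius `2`
  let ρ : ℝ → ℝ := fun s => max 0 (min 1 (2 - s))
  have hρ : Continuous ρ := by fun_prop
  have hρ1 : ∀ s : ℝ, s ≤ 1 → ρ s = 1 := fun s hs => by
    simp only [ρ]
    rw [min_eq_left (by linarith), max_eq_right zero_le_one]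
  have hρ2 : ∀ s : ℝ, 2 ≤ s → ρ s = 0 := fun s hs => by
    simp only [ρ]
    rw [max_eq_left]
    exact min_le_of_right_le (by linarith)
  let cut : ↥(mvU F ∩ mvV F) → ℝ := fun y => ρ ‖((Ψ.symm y).2 : ℂ)‖ * Λ (Ψ.symm y)
  have hcut : Continuous cut :=
    (hρ.comp (continuous_norm.comp (continuous_subtype_val.comp
      (continuous_snd.comp Ψ.symm.continuous)))).mul (Λ.continuous.comp Ψ.symm.continuous)
  have hcutΨ : ∀ p : EuclideanSpace ℝ (Fin 2) × CStar, cut (Ψ p) = ρ ‖(p.2 : ℂ)‖ * Λ p := fun p => by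
    simp only [cut, Homeomorph.symm_apply_apply]
  -- extension by zero to `ℝ⁴ ∖ P`
  classical
  let e : ↥(mvU F) → ℝ := fun y =>
    if h : (y : EuclideanSpace ℝ (Fin 4)) ∈ mvV F then cut ⟨y, y.2, h⟩ else 0
  have he_of_mem : ∀ (y : ↥(mvU F)) (h : (y : EuclideanSpace ℝ (Fin 4)) ∈ mvV F),
      e y = cut ⟨y, y.2, h⟩ := fun y h => dif_pos h
  have he_ι : ∀ p : EuclideanSpace ℝ (Fin 2) × CStar, e (ι (Ψ p)) = ρ ‖(p.2 : ℂ)‖ * Λ p := fun p => by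
    rw [he_of_mem _ (Ψ p).2.2, ← hcutΨ]
    rfl
  set T : Set (EuclideanSpace ℝ (Fin 4)) :=
    radialExt F '' (univ ×ˢ Metric.closedBall (0 : EuclideanSpace ℝ (Fin 2)) 2) with hT
  have hTc : IsClosed T := isClosed_image_radialExt_closedBall hemb hnorm 2
  have hTV : T ⊆ mvV F := by
    rintro _ ⟨q, -, rfl⟩
    exact mem_range_self q
  have he_zero : ∀ y : ↥(mvU F), (y : EuclideanSpace ℝ (Fin 4)) ∉ T → e y = 0 := by
    intro y hyT
    by_cases h : (y : EuclideanSpace ℝ (Fin 4)) ∈ mvV F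
    · obtain ⟨⟨x, w⟩, hxw⟩ := h
      have hw2 : 2 < ‖w‖ := by
        by_contra hle
        exact hyT ⟨(x, w), ⟨mem_univ _, mem_closedBall_zero_iff.2 (not_lt.1 hle)⟩, hxw⟩
      have hw0 : w ≠ 0 := by
        rintro rfl
        rw [norm_zero] at hw2
        linarith
      set z : CStar := ⟨toC w, PlaneComplex.toC_ne_zero hw0⟩ with hz
      have hy : (⟨(y : EuclideanSpace ℝ (Fin 4)), y.2, ⟨(x, w), hxw⟩⟩ : ↥(mvU F ∩ mvV F)) =
          Ψ (x, z) := by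
        apply Subtype.ext
        change (y : EuclideanSpace ℝ (Fin 4)) = radialExt F (x, PlaneComplex.ofC (toC w))
        rw [PlaneComplex.ofC_toC, hxw]
      rw [he_of_mem y ⟨(x, w), hxw⟩, hy, hcutΨ, hρ2 _ ?_, zero_mul]
      change 2 ≤ ‖toC w‖
      rw [norm_toC]
      exact hw2.le
    · exact dif_neg h
  have hA : IsOpen {y : ↥(mvU F) | (y : EuclideanSpace ℝ (Fin 4)) ∈ mvV F} :=
    (isOpenEmbedding_radialExt hemb hnorm).isOpen_range.preimage continuous_subtype_val
  have he_on : ContinuousOn e {y : ↥(mvU F) | (y : EuclideanSpace ℝ (Fin 4)) ∈ mvV F} := by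
    rw [continuousOn_iff_continuous_restrict]
    have heq : ({y : ↥(mvU F) | (y : EuclideanSpace ℝ (Fin 4)) ∈ mvV F}.restrict e) =
        fun a : ↥{y : ↥(mvU F) | (y : EuclideanSpace ℝ (Fin 4)) ∈ mvV F} =>
          cut ⟨((a.1 : ↥(mvU F)) : EuclideanSpace ℝ (Fin 4)), a.1.2, a.2⟩ :=
      funext fun a => dif_pos a.2
    rw [heq]
    exact hcut.comp ((continuous_subtype_val.comp continuous_subtype_val).subtype_mk _)
  have he : Continuous e := by
    rw [continuous_iff_continuousAt]
    intro y
    by_cases hy : (y : EuclideanSpace ℝ (Fin 4)) ∈ mvV F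
    · exact he_on.continuousAt (hA.mem_nhds hy)
    · have hyT : (y : EuclideanSpace ℝ (Fin 4)) ∉ T := fun h => hy (hTV h)
      have hev : (fun _ : ↥(mvU F) => (0 : ℝ)) =ᶠ[𝓝 y] e := by
        filter_upwards [(hTc.isOpen_compl.preimage continuous_subtype_val).mem_nhds hyT] with y' hy'
        exact (he_zero y' hy').symm
      exact continuousAt_const.congr_of_eventuallyEq hev.symm
  -- the normalised circle map
  let θ : C(↥(mvU F), Circle) :=
    ⟨fun y => θ₀ y * (Circle.exp (e y))⁻¹, θ₀.continuous.mul ((Circle.exp.continuous.comp he).inv)⟩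
  have hθ : ∀ y, θ y = θ₀ y * (Circle.exp (e y))⁻¹ := fun y => rfl
  have hθι : ∀ (x : EuclideanSpace ℝ (Fin 2)) (z : CStar), ‖(z : ℂ)‖ ≤ 1 → θ (ι (Ψ (x, z))) = phase (x, z) := by
    intro x z hz
    rw [hθ, he_ι, hρ1 _ hz, one_mul]
    have h1 : θ₀ (ι (Ψ (x, z))) = Θ (x, z) := rfl
    rw [h1, hΘeq, mul_comm (Circle.exp (Λ (x, z))), mul_inv_cancel_right]
  refine ⟨θ, fun x z hz => ?_, fun x₀ r hr h1 => ?_⟩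
  · change ((θ (ι (Ψ (x, z))) : Circle) : ℂ) = _
    rw [hθι x z hz, hphase]
    simp only [Complex.ofReal_inv]
  · refine CircleMaps.winding_eq_of_lift θ _ (G := fun t : unitInterval => 2 * Real.pi * t)
      (by fun_prop) (fun t => ?_) 1 (by simp)
    have hzt : ‖((windingLoop r hr 1 t : CStar) : ℂ)‖ = r := by
      rw [windingLoop_apply_coe, norm_mul, Complex.norm_real, Real.norm_of_nonneg hr.le,
        Complex.norm_exp_ofReal_mul_I, mul_one]
    change Circle.exp (2 * Real.pi * t) = θ (ι (Ψ (x₀, windingLoop r hr 1 t)))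
    rw [hθι x₀ _ (hzt.le.trans h1)]
    apply Subtype.ext
    rw [hphase, Circle.coe_exp, hzt, windingLoop_apply_coe]
    simp only [Int.cast_one, mul_one]
    rw [← mul_assoc, ← Complex.ofReal_mul, inv_mul_cancel₀ hr.ne', Complex.ofReal_one, one_mul]

end NearPlane

/-! ### Restriction to the knot complement: a circle map adapted to the flat tube -/

section KnotNearTube

variable {K : Knot}
variable (hemb : IsEmbedding ((Metric.closedBall (0 : EuclideanSpace ℝ (Fin 2)) 1 ×ˢ
  (univ : Set (EuclideanSpace ℝ (Fin 2)))).restrict F))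
variable (hnorm : ∀ x w : EuclideanSpace ℝ (Fin 2),
  ‖x‖ ≤ 1 → ‖F (x, w)‖ ≤ 1 ∧ (‖F (x, w)‖ = 1 ↔ ‖x‖ = 1))
variable (hK : ∀ x : Metric.sphere (0 : EuclideanSpace ℝ (Fin 2)) 1, F (x, 0) = K x)
include hemb hnorm hK

/-- **A circle-valued map on `S³ ∖ K` which is the fibre phase on the closed unit flat tube and
extends over the flat-disc exterior** — the topological counterpart, for the continuous product
neighbourhood of a flat slice disc, of the circle map of a `0`-framed smooth tube
(`Knot.exists_circleMap_eq_angle_of_hasFraming_zero`, `SeifertCircleMap.lean`; Juhász 2023, proof of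
Prop. 4.10): there are `θ : ℝ⁴ ∖ P → S¹` and its restriction `θ_K = θ ∘ ι : S³ ∖ K → S¹` with
`θ_K (F (x, z)) = z / ‖z‖` for `x ∈ S¹`, `0 < ‖z‖ ≤ 1`; `θ_K` winds once along the meridian and zero
times along the longitude of the flat tube (Livingston 2005, §2 Thm. 2.6, §6).
[cite: Livingston2005, §2 Thm. 2.6] -/
theorem exists_circleMap_complement_eq_phase :
    ∃ θ : C(↥(mvU F), Circle),
      (∀ (x : Metric.sphere (0 : EuclideanSpace ℝ (Fin 2)) 1) (z : CStar) (hz : ‖(z : ℂ)‖ ≤ 1),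
        ((θ.comp (complToPlaneCompl hnorm hK)) (tubeCompl hemb hnorm hK (x, z)) : ℂ) =
          (‖(z : ℂ)‖⁻¹ : ℂ) * (z : ℂ)) ∧
      (∀ (x₀ : Metric.sphere (0 : EuclideanSpace ℝ (Fin 2)) 1) (r : ℝ) (hr : 0 < r) (h1 : r ≤ 1),
        CircleMaps.winding (θ.comp (complToPlaneCompl hnorm hK)) (meridian hemb hnorm hK x₀ r hr) = 1) ∧
      ∀ (w : EuclideanSpace ℝ (Fin 2)) (hw : w ≠ 0),
        CircleMaps.winding (θ.comp (complToPlaneCompl hnorm hK)) (longitude hemb hnorm hK w hw) = 0 := by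
  obtain ⟨θ, hθ, hw⟩ := exists_circleMap_eq_phase_near_plane hemb hnorm
  refine ⟨θ, fun x z hz => ?_, fun x₀ r hr h1 => ?_, fun w hw' => winding_longitude hemb hnorm hK _ w hw'⟩
  · rw [← hθ (x : EuclideanSpace ℝ (Fin 2)) z hz, ContinuousMap.comp_apply]
    congr 2
    apply Subtype.ext
    change F (↑x, PlaneComplex.ofC z) = radialExt F (↑x, PlaneComplex.ofC z)
    rw [radialExt_apply_sphere]
  · rw [winding_comp_complToPlaneCompl_meridian hemb hnorm hK]
    exact hw _ r hr h1

end KnotNearTube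

end TopFlatDisc

end Literature.Topology.FourManifolds

end
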